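import Literature.NumberTheory.EllipticCurves.Kato2004.IwasawaH2DescentRankOne
import Literature.NumberTheory.EllipticCurves.Selmer
import HarnessLib

/-!
# Kato 2004 (Astérisque 295) §14.9 (14.9.3) and §14.14 (14.14.1)–(14.14.2) READ IN THE
# FINITE-`Sel_{p^∞}` CASE (Burungale–Tian 2026, (3.1)): the image of `𝐇¹_Γ(T_pW)/T` has FINITE INDEX in
# `H¹(ℤ[1/p], T_pW)` when `Sel_{p^∞}(W/ℚ)` is finite — ONE named fact on PINNED objects, and its PROVED
# consequence `𝐇²_Γ/T·𝐇²_Γ` finite on every descent package (reading (3.1) of the rank-`0` Kato–zeta road)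

Topic `NumberTheory/EllipticCurves`, sub-directory `Kato2004` (namespace = path).  Cell `bsd-2adic`, prover
seat `bsd-2adic-conv-2` (GEN 10), items stmt-BirchSwinnertonDyer-19219 / -19218 (the rank-`0` `2`-converse
cruxes of route `TwoAdicConverse`).  Companion of `Kato2004/IwasawaH2DescentRankOne.lean` (cell `bsd-cn100`;
named fact `finite_descentCokernel_of_rankOne` = the rank-ONE `Ш[p^∞]`-finite reading, accepted): this file is
its rank-ZERO twin, the binder `h31` of `Summits/…/Theorems/TwoAdicConverseKatoZetaPinned.lean`
(`multiplicativeRankZeroTwoConverse_of_vanK`, `goodOrdinaryRankZeroTwoConverse_of_vanK`; p476479) and of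
`Theorems/TwoAdicConverseKatoZetaRoad.lean` (p422516), i.e. reading (3.1) of Burungale–Tian's deduction of the
rank-`0` `p`-converse (Ann. of Math. 203 (2026) Thm. 3.1, whose (3.1) is printed for a CM newform but deduced
from Kato's GENERAL exact sequence (14.9.3); Remark 3.2: «holds for any elliptic newform»).  Stated ON
PINNED OBJECTS ONLY, from Kato's general statements, with its transport to every package PROVED.

## The statement and its sources (K. Kato, Astérisque 295 (2004); `[p. N]` = printed page; store key
`paper:doi-10-24033-ast-639`, PDF page `N − 115`; A. Burungale–Y. Tian, Ann. of Math. 203 (2026) =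
arXiv:2506.03465, store key `paper:burungale2025-rank-zero-p-converse-theorem-gross-zagier`; read 2026-08-27)

FACT `finite_descentCokernel_of_finite_selmer`: for every elliptic curve `W/ℚ`, prime `p`, cyclotomic
`κ` with topological generator `γ` and pinned `I : IwasawaH1Data W p κ γ`: if `Sel_{p^∞}(W/ℚ)` is FINITE
(`Finite (W.selmerGroupPInfty p)`, i.e. `corank_{ℤ_p} Sel_{p^∞} = 0`, i.e. `H¹_f(ℚ, V_pW) = 0`), then the
image of `proj₀ : 𝐇¹_Γ(T_pW)/T → H¹(ℤ[1/p], T_pW)` has FINITE INDEX — `IwasawaH1Data.descentCokernel I =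
H¹(ℤ[1/p], T_pW) / proj₀(𝐇¹_Γ/T)` is finite.  READING (every step a general printed statement of Kato for
`T = T_pW`, `K = ℚ`, or elementary; none uses CM, the reduction type at `p`, or the parity of `p`):
* (R1) **(14.14.1) [p. 243]** "`0 → 𝐇¹(T)/a𝐇¹(T) → H¹(ℤ[1/p], T) → _a𝐇²(T) → 0`": the cokernel in
  question IS `𝐇²_Γ(T_pW)[T]` (Γ-reading of `IwasawaH2Descent.lean`; on a package:
  `IwasawaH2Data.invariantsEquivCoker`).
* (R2) **(12.2.1) [p. 220] + Thm. 12.4 (1) [p. 221]**: `𝐇²` is a finitely generated TORSION `Λ`-module,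
  hence `𝐇²[T]` is finite iff `𝐇²/T·𝐇²` is finite (the tree theorem
  `IwasawaAlgebra.lengthAt_invariants_eq_lengthAt_coinvariants`; packaged as
  `IwasawaH2Data.finite_descentCokernel_iff_finite_coinvariants_H2`).
* (R3) **(14.14.2) [p. 243]** "`𝐇²(T)/a𝐇²(T) ≅ H²(ℤ[1/p], T)`".
* (R4) **§14.9 [pp. 239–240]**, for "`K` a finite extension of `ℚ` … `T` a finitely generated
  `O_L`-module endowed with a continuous `O_L`-linear action of `Gal(K̄/K)` unramified at almost all
  finite places" with `V` de Rham at `v ∣ p` (true for `T_pE`): **(14.9.3)** "`0 → H¹(O_K[1/p],T)/H¹_f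
  → H¹(K ⊗ ℚ_p, T)/H¹_f →(a) S(K, T*(1) ⊗ ℚ/ℤ)^∨ → H²(O_K[1/p], T) → H²(K ⊗ ℚ_p, T) →
  H⁰(O_K[1/p], T*(1) ⊗ ℚ/ℤ)^∨`… which are exact in the case `p ≠ 2`, and exact up to `×2` in the case
  `p = 2`" [p. 240], the local Tate duality "`H^q(K ⊗ ℚ_p, T) ≅ {H^{2−q}(K ⊗ ℚ_p, T*(1) ⊗ ℚ/ℤ)}^∨`"
  [p. 239] (so `H²(ℚ_p, T_pE) ≅ E(ℚ_p)[p^∞]^∨` is FINITE), and **§14.1 [p. 235]** "If `A` is an abelian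
  variety over `K`, the usual Selmer group `Sel(K, A)` of `A` coincides with `Sel(K, T_p(A))`" (with
  `T_pE*(1) ≅ T_pE` by the Weil pairing, `S(ℚ, T*(1) ⊗ ℚ/ℤ) = Sel_{p^∞}(E/ℚ)`).
* (R5₀) elementary: if `Sel_{p^∞}(E/ℚ)` is finite, so is its Pontryagin dual `S(ℚ, T*(1) ⊗ ℚ/ℤ)^∨`;
  by (14.9.3) `H²(ℤ[1/p], T_pE)` then sits between a quotient of that finite dual and the finite
  `H²(ℚ_p, T_pE)`, hence is finite (at `p = 2` "up to `×2`" changes finitely generated `ℤ_2`-modules by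
  finite groups, so finiteness is unaffected).  Kato prints this very deduction in 14.13 [p. 243]: "We prove
  the finiteness of `H²(ℤ[1/p], T)` … By the sequence (14.9.3), this follows from the finiteness of
  `S(T*(1))` and the finiteness of `H²(ℚ_p, T)`" (there `S(T*(1))` is finite because `L(E,1) ≠ 0`,
  Thm. 14.2; here its finiteness IS the hypothesis).
Chain: `Sel_{p^∞}` finite ⟹(R5₀,R4) `H²(ℤ[1/p], T_pW)` finite ⟹(R3) `𝐇²_Γ/T·𝐇²_Γ` finite ⟹(R2) `𝐇²_Γ[T]`
finite ⟹(R1) the index is finite.  PRINTED INSTANCE of the conclusion of (R5₀,R4): Burungale–Tian, proof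
of Thm. 3.1 [p. 6]: "Since `H¹_f(ℚ, V_{F_λ}(f)(k/2)) = 0`, by the exact sequence [12, (14.9.3)], note that
(3.1) `H²(ℤ[1/p], T(k/2)) ⊗ ℚ = 0`" (stated for a CM newform `f` and ANY prime `p`; the sentence uses only
(14.9.3); Remark 3.2 [p. 6]: "This deduction of the rank zero `p`-converse from Kato's main conjecture holds
for any elliptic newform").  Referee flag: `Kato-14.9.3-14.14-finite-selmer-reading` (non-verbatim: the
Γ-reading of §14.14 as in `IwasawaH2Descent.lean`; the identification of `S(ℚ, T*(1) ⊗ ℚ/ℤ)` with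
`Sel_{p^∞}(E/ℚ)`; at `p = 2` the "up to ×2" clause).

WHY ON PINNED OBJECTS (as in the rank-one twin).  `descentCokernel I` mentions only the tree's
`IwasawaH1Data`, `integralH1`, `projZero`; no abstract `𝐇²` occurs in the fact.  Its consequence for ANY
package `J : IwasawaH2Data W p κ γ I` — `Finite (coinvariants p J.H2)`, the roads' `h31` — is a THEOREM here
(`IwasawaH2Data.finite_coinvariants_H2_of_finite_selmer`), through the proved equivalence
`Finite (descentCokernel I) ↔ Finite (coinvariants p J.H2)`.  So the fact is exactly as strong as "(3.1) for
Kato's genuine `𝐇²_Γ(T_pW)`", neither more nor less; it says NOTHING about `L(E,1)` (the rank-`0`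
`p`-converse needs, beyond it, Kato's Main Conjecture 12.10 for the zeta element and the explicit reciprocity
law Thm. 12.5 (1) — Burungale–Tian (3.2)–(3.3)).

HONEST FRAMING: one named fact (D-0014; review-queued; net debt +1), everything else PROVED; BSD is not
advanced; nothing about the `2`-converse cruxes 19218/19219 is claimed (they stay OPEN); the fact is a cited
reading of Kato's general theorems (size L if one wanted `_holds`: Poitou–Tate for `T_pE` over `ℚ`,
(14.14.2)).  No `instance`, no notation.

## References

* K. Kato, *p-adic Hodge theory and values of zeta functions of modular forms*, Astérisque 295 (2004):
  §12.2 (12.2.1) (p. 220), Thm. 12.4 (1) (p. 221), §14.1 (p. 235), §14.9 (14.9.1)–(14.9.5) and the local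
  duality (pp. 239–240), 14.13 (p. 243), §14.14 (14.14.1)–(14.14.2) (p. 243). [Kato2004Asterisque]
* A. A. Burungale, Y. Tian, *A rank zero `p`-converse to a theorem of Gross–Zagier, Kolyvagin and Rubin*,
  Ann. of Math. (2) 203 (2026) = arXiv:2506.03465: Thm. 3.1 and its proof, eq. (3.1), Remark 3.2 (p. 6).
  [BurungaleTian2026]
* Tree: `Kato2004/IwasawaH2DescentRankOne.lean` (`IwasawaH1Data.descentCokernel`,
  `IwasawaH2Data.finite_descentCokernel_iff_finite_coinvariants_H2`, the rank-one twin
  `finite_descentCokernel_of_rankOne`), `Kato2004/IwasawaH2Descent.lean` (`IwasawaH2Data`),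
  `Kato2004/IwasawaCohomology.lean` (`IwasawaH1Data`), `Selmer.lean` (`WeierstrassCurve.selmerGroupPInfty`).
-/

noncomputable section

open Field
open Literature.NumberTheory.GaloisRepresentations
open Literature.NumberTheory.EllipticCurves Literature.NumberTheory.EllipticCurves.Kato2004
open Literature.NumberTheory.EllipticCurves.Kato2004.EulerSystemValues
open Literature.NumberTheory.EllipticCurves.IwasawaAlgebra

namespace Literature.NumberTheory.EllipticCurves.Kato2004

/-! ## §1 The named fact ((14.9.3) + (14.14.1)–(14.14.2) in the finite-`Sel_{p^∞}` case) -/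

/-- **Kato 2004, (14.14.1)–(14.14.2) (p. 243) with (14.9.3) (p. 240, `K = ℚ`, `T = T_pW`), the local
duality `H²(ℚ_p, T) ≅ H⁰(ℚ_p, T*(1) ⊗ ℚ/ℤ)^∨` (p. 239), §14.1 (p. 235) and (12.2.1)/Thm. 12.4 (1), READ in
the finite-`Sel_{p^∞}` case (module docstring (R1)–(R5₀); printed instance of the decisive step:
Burungale–Tian 2026, proof of Thm. 3.1, (3.1) "Since `H¹_f(ℚ, V) = 0`, by the exact sequence [12, (14.9.3)],
`H²(ℤ[1/p], T) ⊗ ℚ = 0`", any prime `p`, with Remark 3.2): the image of `𝐇¹_Γ(T_pW)/T` under `proj₀` has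
FINITE INDEX in `H¹(ℤ[1/p], T_pW)` whenever `Sel_{p^∞}(W/ℚ)` is finite.**  For every elliptic curve `W/ℚ`,
every prime `p`, every cyclotomic `ℤ_p`-extension datum `κ` with topological generator `γ` and every pinned
`I : IwasawaH1Data W p κ γ`: if `Sel_{p^∞}(W/ℚ)` is finite (`Finite (W.selmerGroupPInfty p)`), then
`IwasawaH1Data.descentCokernel I = H¹(ℤ[1/p], T_pW) / proj₀(𝐇¹_Γ/T)` is finite.  By (14.14.1) this cokernel
is `𝐇²_Γ(T_pW)[T]`, which for the finitely generated torsion module `𝐇²_Γ` is finite iff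
`𝐇²_Γ/T·𝐇²_Γ = H²(ℤ[1/p], T_pW)` ((14.14.2)) is, and the latter is finite by (14.9.3) because the Pontryagin
dual of the finite `S(ℚ, T*(1) ⊗ ℚ/ℤ) = Sel_{p^∞}(E/ℚ)` and `H²(ℚ_p, T_pE) ≅ E(ℚ_p)[p^∞]^∨` are finite
(Kato's own pattern of 14.13, p. 243).  A statement on PINNED objects only (no abstract module); its
transport to every descent package is the theorem `IwasawaH2Data.finite_coinvariants_H2_of_finite_selmer`
below (= the binder `h31` of the rank-`0` Kato–zeta road).  The rank-ZERO twin of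
`finite_descentCokernel_of_rankOne`.  Weaker than print in scope (only `T_pW`, `K = ℚ`, the finite-Selmer
case), never stronger.  Named fact; nothing asserted; no `_holds` expected soon (size L).  Referee flag
`Kato-14.9.3-14.14-finite-selmer-reading`.
[cite: Kato2004Asterisque, §14.14 (14.14.1)–(14.14.2) (p. 243), §14.9 (14.9.3) and local duality (pp. 239–240), 14.13 (p. 243), §14.1 (p. 235), §12.2 (12.2.1) (p. 220), Thm. 12.4 (1) (p. 221)]
[cite: BurungaleTian2026, Thm. 3.1 (proof, eq. (3.1), p. 6) and Remark 3.2 (printed instance: CM newform, any prime p; deduction general)] -/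
def finite_descentCokernel_of_finite_selmer : Prop :=
  ∀ (W : WeierstrassCurve ℚ) [W.IsElliptic] (p : ℕ) [Fact p.Prime]
    [ContinuousSMul ℤ_[p] (W.tateModule p)] (κ : ZpExtension ℚ p) (γ : absoluteGaloisGroup ℚ),
    κ.IsCyclotomic → κ.IsTopGenerator γ → ∀ I : IwasawaH1Data W p κ γ,
      Finite (W.selmerGroupPInfty p) → Finite (IwasawaH1Data.descentCokernel I)

/-! ## §2 Consumer form: `𝐇²_Γ/T·𝐇²_Γ` finite on every descent package -/

/-- **Consumer form = the rank-`0` roads' binder `h31` on a package** (reading (3.1) of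
`Theorems/TwoAdicConverseKatoZetaPinned.lean` / `…KatoZetaRoad.lean`): under
`finite_descentCokernel_of_finite_selmer`, for every cyclotomic `κ`, topological generator `γ`, pinned `I`
and descent package `J : IwasawaH2Data W p κ γ I`, `Sel_{p^∞}(W/ℚ)` finite ⟹ `𝐇²_Γ/T·𝐇²_Γ` finite — PROVED
from the fact by (14.14.1) on the pin and the `lengthAt` calculus
(`IwasawaH2Data.finite_descentCokernel_iff_finite_coinvariants_H2`).
[cite: Kato2004Asterisque, §14.14 (14.14.1)–(14.14.2) (p. 243) and (14.9.3) (p. 240)]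
[cite: BurungaleTian2026, Thm. 3.1 (proof, eq. (3.1), p. 6)] -/
theorem IwasawaH2Data.finite_coinvariants_H2_of_finite_selmer (h : finite_descentCokernel_of_finite_selmer)
    {W : WeierstrassCurve ℚ} [W.IsElliptic] {p : ℕ} [Fact p.Prime]
    [ContinuousSMul ℤ_[p] (W.tateModule p)] {κ : ZpExtension ℚ p} {γ : absoluteGaloisGroup ℚ}
    (hκ : κ.IsCyclotomic) (hγ : κ.IsTopGenerator γ) {I : IwasawaH1Data W p κ γ}
    (J : IwasawaH2Data W p κ γ I) (hfin : Finite (W.selmerGroupPInfty p)) :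
    Finite (coinvariants p J.H2) :=
  J.finite_descentCokernel_iff_finite_coinvariants_H2.mp (h W p κ γ hκ hγ I hfin)

end Literature.NumberTheory.EllipticCurves.Kato2004

end
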